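import Mathlib
import Literature.Probability.MarkovChains.TotalVariation
import Literature.Probability.Entropy.BinaryRelativeEntropy
import Literature.InformationTheory.Entropy.GibbsInequality
import Summits.Ventures.LatticeQCDFlow.Exactness.FlowMCMC
import Summits.Ventures.LatticeQCDFlow.Scaling.ImportanceWeights
import Summits.Ventures.LatticeQCDFlow.Scaling.SectorBudget
import Summits.Ventures.LatticeQCDFlow.Scaling.BlockDefect
import Summits.Ventures.LatticeQCDFlow.Scaling.StochasticBudgets

/-!
# LatticeQCDFlow / Scaling — reverse-KL training is mode-SEEKING: the exchange rate of dropping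
# a topological sector (T2-Y)

HONEST FRAMING: exact (Metropolis-corrected) sampling algorithms for lattice gauge theory;
figures of merit are autocorrelation/cost numbers at stated couplings and volumes; no
continuum-physics claim.

Venture `LatticeQCDFlow` (cell pub-lqcd), topic `Scaling`, THEORY-2.md §3.6 / §4 T2-Y (v1.6),
prepared for landing by the theory seat (FANOUT row 29) from `HOME/THEORY-2-Sketch.lean` v1.8,
rebased on the tree's `Scaling/SectorBudget` (`coarse`, `sum_coarse`, `coarse_pos`),
`Scaling/{ImportanceWeights, BlockDefect, StochasticBudgets}` (`essFrac`, `klFin`,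
`essFrac_eq_sq_div`) and `Literature.Probability.Entropy.BinaryRelativeEntropy` (`binaryKL`).

A SECTOR-RESCALED model `q = p · g∘π` (right within each sector, wrong sector weights) has
reverse KL, forward KL and reweighting ESS EQUAL to their values on the sector weights alone
(`klFin_rescaled_rev`, `klFin_rescaled_fwd`, `essFrac_rescaled`: the equality cases of
the data-processing budget T2-P, tree `SectorBudget`).  So the reverse-KL price of shrinking a
sector of true mass `a` to model mass `ε` is exactly `binaryKL ε a ≤ −log(1 − a)` nats — BOUNDED
(`binaryKL_collapse_le`; `0.223` at `a = 0.2`, `log 2` at `a = 1/2`), whereas the sampler pays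
`ESS ≤ ε/a²` (`essFrac_le_event_ratio`, `inv_twoSector_le`), forward KL `≥ a log(a/ε) + (1−a) log(1−a) → ∞`
(`binaryKL_collapse_ge`), and (tree T2-D/T2-R, `imh_sector_mixing_lower_bound`) `≳ a/ε` sweeps
of sector freezing.  A reverse-KL optimiser facing ANY in-sector modelling difficulty worth more
than `−log(1−a)` nats drops the sector.  Printed counterpart (qualitative): arXiv:2107.00734 §II
("mode-seeking"), Nicoli et al. 2023 (arXiv:2302.14082) §IV (mode-dropping / forward-KL
remedies), arXiv:2211.07541 §IV.

Elementary (`[folklore]`-level); farm `lean check` rc 0, no `sorry`.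
-/

namespace Summit.Ventures.LatticeQCDFlow.Theory2

open Finset
open Literature.Probability.MarkovChains
open Summit.Ventures.LatticeQCDFlow.Exactness

variable {X : Type*} [Fintype X]

section SectorRescaled

variable {Y : Type*} [Fintype Y] [DecidableEq Y]

omit [Fintype Y] in
/-- Sector weights of a sector-rescaled law: `π_*(p · g∘π) = (π_* p) · g`. [folklore] -/
theorem coarse_mul_comp (π : X → Y) (p : X → ℝ) (g : Y → ℝ) :
    coarse π (fun x => p x * g (π x)) = fun k => coarse π p k * g k := by
  funext k
  unfold coarse
  rw [sum_mul]
  exact sum_congr rfl fun x hx => by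
    show p x * g (π x) = p x * g k
    rw [(mem_filter.1 hx).2]

/-- Fibrewise transfer of a sector observable: `Σ_x p x · h(π x) = Σ_k (π_* p)_k · h k`. -/
theorem sum_mul_comp_eq_sum_coarse (π : X → Y) (p : X → ℝ) (h : Y → ℝ) :
    ∑ x, p x * h (π x) = ∑ k, coarse π p k * h k := by
  rw [← sum_fiberwise univ π (fun x => p x * h (π x))]
  refine sum_congr rfl fun k _ => ?_
  rw [coarse, sum_mul]
  exact sum_congr rfl fun x hx => by
    show p x * h (π x) = p x * h k
    rw [(mem_filter.1 hx).2]

/-- **T2-Y (reverse KL of a sector-rescaled model lives on the sectors; proved).**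
`D(p·g∘π ‖ p) = D(π_*(p·g∘π) ‖ π_* p)` — the TRAINING objective sees only the sector weights. -/
theorem klFin_rescaled_rev (π : X → Y) {p : X → ℝ} (g : Y → ℝ) (hp : ∀ x, 0 < p x) :
    klFin (fun x => p x * g (π x)) p =
      klFin (coarse π (fun x => p x * g (π x))) (coarse π p) := by
  rw [coarse_mul_comp]
  unfold klFin
  have hL : ∀ x, p x * g (π x) * Real.log (p x * g (π x) / p x) =
      p x * (g (π x) * Real.log (g (π x))) := fun x => by
    rw [mul_div_cancel_left₀ _ (hp x).ne']; ring
  have hR : ∀ k, coarse π p k * g k * Real.log (coarse π p k * g k / coarse π p k) =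
      coarse π p k * (g k * Real.log (g k)) := fun k => by
    rcases eq_or_ne (coarse π p k) 0 with h0 | h0
    · rw [h0]; simp
    · rw [mul_div_cancel_left₀ _ h0]; ring
  simp_rw [hL, hR]
  exact sum_mul_comp_eq_sum_coarse π p (fun k => g k * Real.log (g k))

/-- **T2-Y (forward KL of a sector-rescaled model lives on the sectors; proved).** -/
theorem klFin_rescaled_fwd (π : X → Y) {p : X → ℝ} (g : Y → ℝ) (hp : ∀ x, 0 < p x) :
    klFin p (fun x => p x * g (π x)) =
      klFin (coarse π p) (coarse π (fun x => p x * g (π x))) := by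
  rw [coarse_mul_comp]
  unfold klFin
  have hL : ∀ x, p x * Real.log (p x / (p x * g (π x))) = p x * Real.log (g (π x))⁻¹ :=
    fun x => by rw [← div_div, div_self (hp x).ne', one_div]
  have hR : ∀ k, coarse π p k * Real.log (coarse π p k / (coarse π p k * g k)) =
      coarse π p k * Real.log (g k)⁻¹ := fun k => by
    rcases eq_or_ne (coarse π p k) 0 with h0 | h0
    · rw [h0]; simp
    · rw [← div_div, div_self h0, one_div]
  simp_rw [hL, hR]
  exact sum_mul_comp_eq_sum_coarse π p (fun k => Real.log (g k)⁻¹)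

/-- **T2-Y (ESS of a sector-rescaled model lives on the sectors; proved).** -/
theorem essFrac_rescaled (π : X → Y) {p : X → ℝ} {g : Y → ℝ} (hp : ∀ x, 0 < p x)
    (hg : ∀ k, 0 < g k) (hπ : Function.Surjective π) :
    essFrac p (fun x => p x * g (π x)) =
      essFrac (coarse π p) (coarse π (fun x => p x * g (π x))) := by
  rw [coarse_mul_comp, essFrac_eq_sq_div (fun x => mul_ne_zero (hp x).ne' (hg (π x)).ne'),
    essFrac_eq_sq_div (fun k => mul_ne_zero (coarse_pos π hp hπ k).ne' (hg k).ne'), sum_coarse]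
  congr 1
  have hL : ∀ x, p x ^ 2 / (p x * g (π x)) = p x * (g (π x))⁻¹ := fun x => by
    rw [sq, mul_div_mul_left _ _ (hp x).ne', div_eq_mul_inv]
  have hR : ∀ k, coarse π p k ^ 2 / (coarse π p k * g k) = coarse π p k * (g k)⁻¹ := fun k => by
    rw [sq, mul_div_mul_left _ _ (coarse_pos π hp hπ k).ne', div_eq_mul_inv]
  simp_rw [hL, hR]
  exact sum_mul_comp_eq_sum_coarse π p (fun k => (g k)⁻¹)

end SectorRescaled

section SectorPrices

open Literature.Probability.Entropy

/-- **T2-Y (the reverse-KL price of dropping a sector is bounded; proved).**  With true sector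
mass `a < 1` and model mass `0 < ε ≤ a`: `binaryKL ε a ≤ −log(1 − a)` (the sector-level reverse
KL; by `klFin_rescaled_rev` it is ATTAINED by the sector-rescaled model, and by
`binaryKL_event_le_klFin` it is the minimum over all models with `q(sector) = ε`). [folklore] -/
theorem binaryKL_collapse_le {a ε : ℝ} (hε : 0 < ε) (hεa : ε ≤ a) (ha1 : a < 1) :
    binaryKL ε a ≤ -Real.log (1 - a) := by
  unfold binaryKL
  have ha : 0 < a := hε.trans_le hεa
  have h1 : Real.log (ε / a) ≤ 0 :=
    Real.log_nonpos (div_pos hε ha).le ((div_le_one ha).2 hεa)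
  have h2 : Real.log (1 - ε) ≤ 0 := Real.log_nonpos (by linarith) (by linarith)
  have h3 : Real.log (1 - a) ≤ 0 := Real.log_nonpos (by linarith) (by linarith)
  rw [Real.log_div (sub_pos.2 (by linarith : ε < 1)).ne' (sub_pos.2 ha1).ne']
  have e1 : 0 ≤ ε * -Real.log (ε / a) := mul_nonneg hε.le (by linarith)
  have e2 : 0 ≤ (1 - ε) * -Real.log (1 - ε) := mul_nonneg (by linarith) (by linarith)
  have e3 : 0 ≤ ε * -Real.log (1 - a) := mul_nonneg hε.le (by linarith)
  nlinarith

/-- **T2-Y (the forward-KL price of dropping a sector is unbounded; proved).**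
`binaryKL a ε ≥ a log(a/ε) + (1 − a) log(1 − a)` (→ ∞ as `ε → 0`); with
`binaryKL_event_le_klFin` this bounds `D(p‖q)` below for every model with `q(sector) = ε`.
[folklore] -/
theorem binaryKL_collapse_ge {a ε : ℝ} (hε : 0 ≤ ε) (hε1 : ε < 1) (ha1 : a < 1) :
    a * Real.log (a / ε) + (1 - a) * Real.log (1 - a) ≤ binaryKL a ε := by
  unfold binaryKL
  have h : Real.log (1 - a) ≤ Real.log ((1 - a) / (1 - ε)) := by
    rw [Real.log_div (sub_pos.2 ha1).ne' (sub_pos.2 hε1).ne']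
    linarith [Real.log_nonpos (by linarith : (0:ℝ) ≤ 1 - ε) (by linarith : 1 - ε ≤ (1:ℝ))]
  nlinarith [mul_le_mul_of_nonneg_left h (by linarith : (0:ℝ) ≤ 1 - a)]

/-- **T2-Y (sharp event ESS budget; proved).**  `ESS(p, q) ≤ q(E) / p(E)²` for every event `E`
(Cauchy–Schwarz on `E`): model mass `ε` on a sector of true mass `a` caps `ESS ≤ ε/a²`
(`a = 0.2`, `ε = 10⁻³` ⇒ `ESS ≤ 0.025`), at any acceptance. [folklore] -/
theorem essFrac_le_event_ratio (E : Finset X) {p q : X → ℝ} (hq : ∀ x, 0 < q x)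
    (hp1 : ∑ x, p x = 1) (hpE : 0 < ∑ x ∈ E, p x) :
    essFrac p q ≤ (∑ x ∈ E, q x) / (∑ x ∈ E, p x) ^ 2 := by
  rw [essFrac_eq_inv hq hp1]
  simp_rw [mul_weight_eq_sq_div]
  have hne : E.Nonempty := by
    by_contra h
    rw [not_nonempty_iff_eq_empty] at h
    rw [h, sum_empty] at hpE
    exact lt_irrefl _ hpE
  have hqE : 0 < ∑ x ∈ E, q x := sum_pos (fun y _ => hq y) hne
  have hCS := Finset.sq_sum_div_le_sum_sq_div E p (fun x _ => hq x)
  have hsub : ∑ x ∈ E, p x ^ 2 / q x ≤ ∑ x, p x ^ 2 / q x :=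
    sum_le_sum_of_subset_of_nonneg (subset_univ E) fun x _ _ =>
      div_nonneg (sq_nonneg _) (hq x).le
  have hpos : 0 < (∑ x ∈ E, p x) ^ 2 / ∑ x ∈ E, q x := div_pos (pow_pos hpE 2) hqE
  calc (∑ x, p x ^ 2 / q x)⁻¹ ≤ ((∑ x ∈ E, p x) ^ 2 / ∑ x ∈ E, q x)⁻¹ :=
        inv_anti₀ hpos (hCS.trans hsub)
    _ = (∑ x ∈ E, q x) / (∑ x ∈ E, p x) ^ 2 := inv_div _ _

/-- The two-sector ESS value is at most `ε / a²`. [folklore] -/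
theorem inv_twoSector_le {a ε : ℝ} (hε : 0 < ε) (hε1 : ε < 1) (ha : 0 < a) :
    (a ^ 2 / ε + (1 - a) ^ 2 / (1 - ε))⁻¹ ≤ ε / a ^ 2 := by
  have h1 : 0 < a ^ 2 / ε := div_pos (pow_pos ha 2) hε
  have h2 : 0 ≤ (1 - a) ^ 2 / (1 - ε) := div_nonneg (sq_nonneg _) (by linarith)
  calc (a ^ 2 / ε + (1 - a) ^ 2 / (1 - ε))⁻¹ ≤ (a ^ 2 / ε)⁻¹ :=
        inv_anti₀ h1 (le_add_of_nonneg_right h2)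
    _ = ε / a ^ 2 := inv_div _ _

end SectorPrices

end Summit.Ventures.LatticeQCDFlow.Theory2
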